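import Summits.BirchSwinnertonDyer.BirchSwinnertonDyer.Statement
import Literature.NumberTheory.EllipticCurves.LeadingTerm
import Literature.NumberTheory.EllipticCurves.Selmer
import Literature.NumberTheory.EllipticCurves.KatoRankBound
import HarnessLib

/-!
# SoloInformedOpenCore — the open core of RANK, typed against the tree

Kernel-checked bookkeeping that pins WHERE the Birch–Swinnerton-Dyer rank conjecture
(`BirchSwinnertonDyer` = `Literature.BSDRankConjecture`: `r_an(E) = rank E(ℚ)` for every `E/ℚ`)
is open, relative to named facts already in the Literature library (taken as hypotheses):

* `soloInformed_birchSwinnertonDyer_iff_of_gzk`: over the Gross–Zagier–Kolyvagin fact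
  `rank_eq_analyticRank_of_analyticRank_le_one` (`r_an ≤ 1 ⇒ rank = r_an ∧ Ш finite`;
  Gross–Zagier 1986, Kolyvagin 1990; Gross, PCMS 18 (2011) Thm. 3.3) the summit is EQUIVALENT to
  its restriction to curves of analytic rank `≥ 2`.
* `soloInformed_birchSwinnertonDyer_of_ub_of_lb`: that restriction is the conjunction of the two
  one-sided inequalities `UB₂ : 2 ≤ r_an ⇒ rank ≤ r_an` and `LB₂ : 2 ≤ r_an ⇒ r_an ≤ rank`.
* `soloInformed_ub_of_selmerDoor`, `soloInformed_lb_of_selmerDoor`: over the corank identity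
  `selmerCorank_eq_mordellWeilRank_add` (`corank Sel_{p^∞} = rank + corank Ш[p^∞]`; Greenberg,
  LNM 1716 (1999) §1) `UB₂` follows from a Selmer UPPER door `∃ p, corank Sel_{p^∞}(E) ≤ r_an(E)`
  alone, while `LB₂` needs a Selmer LOWER door `r_an ≤ corank Sel_{p^∞}` AND `corank Ш[p^∞] = 0`
  at the same prime: upper bounds pass through Selmer groups for free, lower bounds need `Ш`.
* `soloInformed_ub_of_padicOrderDoor`: over Kato's bound
  `kato_selmerCorank_le_order_padicLFunction` (`corank Sel_{p^∞} ≤ ord_{T=0} L_p(E,T)` at an odd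
  good ordinary prime; Kato, Astérisque 295 (2004) Thm. 18.4) the Selmer upper door, hence `UB₂`
  for globally minimal models, follows from the single statement
  `∃ p odd good ordinary: ord_{T=0} L_p(E,T) ≤ ord_{s=1} L(E,s)` ("the cyclotomic `p`-adic order of
  vanishing is at most the complex one"), open in print beyond order `1` (order `≤ 1` is the
  interpolation formula `L_p(E,0) = (1-α⁻¹)² L(E,1)/Ω⁺`, Mazur–Tate–Teitelbaum 1986 §I.14).

The proofs are logic over the named facts; the content is the typing of the doors.
-/

noncomputable section

open scoped Classical
open scoped MatrixGroups ModularForm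

open CongruenceSubgroup Literature.NumberTheory.EllipticCurves
  Literature.NumberTheory.EllipticCurves.ModularForms WeierstrassCurve

namespace Summit.BirchSwinnertonDyer.BirchSwinnertonDyer.Theorems

/-- **Localisation of RANK at analytic rank `≥ 2`.** Over the Gross–Zagier–Kolyvagin theorem
(`rank_eq_analyticRank_of_analyticRank_le_one`: `r_an(E) ≤ 1 ⇒ rank E(ℚ) = r_an(E)`;
Gross, PCMS 18 (2011), Thm. 3.3), the BSD rank conjecture is equivalent to its restriction to
elliptic curves of analytic rank at least `2`. [cite: GrossPCMS2011, Thm. 3.3] -/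
theorem soloInformed_birchSwinnertonDyer_iff_of_gzk
    (hGZK : rank_eq_analyticRank_of_analyticRank_le_one) :
    BirchSwinnertonDyer ↔
      ∀ (W : WeierstrassCurve ℚ) [W.IsElliptic], 2 ≤ W.analyticRank →
        W.analyticRank = W.mordellWeilRank := by
  unfold BirchSwinnertonDyer Literature.BSDRankConjecture
  constructor
  · intro h W hW h2
    exact h W hW
  · intro h W hW
    by_cases h2 : 2 ≤ W.analyticRank
    · exact @h W hW h2
    · have h1 : W.analyticRank ≤ 1 := by omega
      exact (hGZK W h1).1.symm

/-- **RANK from the two one-sided inequalities at analytic rank `≥ 2`.** Over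
Gross–Zagier–Kolyvagin, `BirchSwinnertonDyer` follows from
`UB₂ : 2 ≤ r_an(E) ⇒ rank E(ℚ) ≤ r_an(E)` and `LB₂ : 2 ≤ r_an(E) ⇒ r_an(E) ≤ rank E(ℚ)`.
[cite: GrossPCMS2011, Thm. 3.3] -/
theorem soloInformed_birchSwinnertonDyer_of_ub_of_lb
    (hGZK : rank_eq_analyticRank_of_analyticRank_le_one)
    (hUB : ∀ (W : WeierstrassCurve ℚ) [W.IsElliptic], 2 ≤ W.analyticRank →
      W.mordellWeilRank ≤ W.analyticRank)
    (hLB : ∀ (W : WeierstrassCurve ℚ) [W.IsElliptic], 2 ≤ W.analyticRank →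
      W.analyticRank ≤ W.mordellWeilRank) :
    BirchSwinnertonDyer :=
  (soloInformed_birchSwinnertonDyer_iff_of_gzk hGZK).2 fun W _ h2 =>
    le_antisymm (hLB W h2) (hUB W h2)

/-- **Selmer upper door.** Over the corank identity `corank Sel_{p^∞}(E/ℚ) = rank E(ℚ) +
corank Ш(E/ℚ)[p^∞]` (`selmerCorank_eq_mordellWeilRank_add`; Greenberg, LNM 1716 (1999), §1),
the upper inequality `UB₂` follows from: for every `E/ℚ` with `r_an ≥ 2` there is a prime `p`
with `corank Sel_{p^∞}(E/ℚ) ≤ r_an(E)`. No finiteness of `Ш` is needed on this side.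
[cite: GreenbergLNM1716, §1] -/
theorem soloInformed_ub_of_selmerDoor
    (hSel : ∀ (W : WeierstrassCurve ℚ), W.selmerCorank_eq_mordellWeilRank_add)
    (hD : ∀ (W : WeierstrassCurve ℚ) [W.IsElliptic], 2 ≤ W.analyticRank →
      ∃ (p : ℕ) (_ : Fact p.Prime), W.selmerCorank p ≤ W.analyticRank) :
    ∀ (W : WeierstrassCurve ℚ) [W.IsElliptic], 2 ≤ W.analyticRank →
      W.mordellWeilRank ≤ W.analyticRank := by
  intro W hW h2
  obtain ⟨p, hp, hle⟩ := hD W h2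
  have h' : W.selmerCorank_eq_mordellWeilRank_add := hSel W
  have hid : W.selmerCorank p = W.mordellWeilRank + W.shaCorank p := h' p
  omega

/-- **Selmer lower door.** Over the corank identity `selmerCorank_eq_mordellWeilRank_add`
(Greenberg, LNM 1716 (1999), §1), the lower inequality `LB₂` follows from: for every `E/ℚ` with
`r_an ≥ 2` there is a prime `p` with `r_an(E) ≤ corank Sel_{p^∞}(E/ℚ)` AND
`corank Ш(E/ℚ)[p^∞] = 0`. Both conjuncts at the same prime are used; dropping the second is the
Selmer-versus-Mordell–Weil gap. [cite: GreenbergLNM1716, §1] -/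
theorem soloInformed_lb_of_selmerDoor
    (hSel : ∀ (W : WeierstrassCurve ℚ), W.selmerCorank_eq_mordellWeilRank_add)
    (hD : ∀ (W : WeierstrassCurve ℚ) [W.IsElliptic], 2 ≤ W.analyticRank →
      ∃ (p : ℕ) (_ : Fact p.Prime), W.analyticRank ≤ W.selmerCorank p ∧ W.shaCorank p = 0) :
    ∀ (W : WeierstrassCurve ℚ) [W.IsElliptic], 2 ≤ W.analyticRank →
      W.analyticRank ≤ W.mordellWeilRank := by
  intro W hW h2
  obtain ⟨p, hp, hle, hsha⟩ := hD W h2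
  have h' : W.selmerCorank_eq_mordellWeilRank_add := hSel W
  have hid : W.selmerCorank p = W.mordellWeilRank + W.shaCorank p := h' p
  omega

/-- **`p`-adic order door for the upper inequality.** Over Kato's theorem
`kato_selmerCorank_le_order_padicLFunction` (`corank Sel_{p^∞}(E/ℚ) ≤ ord_{T=0} L_p(E,T)` for an
odd good ordinary prime `p`, `L_p` built from the newform of `E` and its unit root; Kato,
Astérisque 295 (2004), Thm. 18.4) and the corank identity (Greenberg 1999 §1), the upper
inequality `UB₂` for globally minimal models follows from the single door: for every such `E/ℚ`
with `r_an ≥ 2` there are an odd good ordinary prime `p` and the newform `f` of `E` with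
`ord_{T=0} L_p(E,T) ≤ ord_{s=1} L(E,s)`. [cite: Kato2004, Thm 18.4] -/
theorem soloInformed_ub_of_padicOrderDoor
    (hSel : ∀ (W : WeierstrassCurve ℚ), W.selmerCorank_eq_mordellWeilRank_add)
    (hKato : ∀ (W : WeierstrassCurve ℚ) [W.IsElliptic] [W.IsGloballyMinimal] (p : ℕ)
      [Fact p.Prime] {N : ℕ} [NeZero N] {f : CuspForm (Gamma0 N) 2},
      kato_selmerCorank_le_order_padicLFunction W p (f := f))
    (hD : ∀ (W : WeierstrassCurve ℚ) [W.IsElliptic] [W.IsGloballyMinimal], 2 ≤ W.analyticRank →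
      ∃ (p : ℕ) (_ : Fact p.Prime) (N : ℕ) (_ : NeZero N) (f : CuspForm (Gamma0 N) 2),
        p ≠ 2 ∧ IsOrdinaryAt W p ∧ IsNewformOf W f ∧
        (padicLFunction f (unitRoot W p : ℚ_[p])).order ≤ (W.analyticRank : ℕ∞)) :
    ∀ (W : WeierstrassCurve ℚ) [W.IsElliptic] [W.IsGloballyMinimal], 2 ≤ W.analyticRank →
      W.mordellWeilRank ≤ W.analyticRank := by
  intro W hW hmin h2
  obtain ⟨p, hp, N, hN, f, hp2, hord, hf, hle⟩ := hD W h2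
  have hK : kato_selmerCorank_le_order_padicLFunction W p (f := f) := hKato W p
  have h1 : (W.selmerCorank p : ℕ∞) ≤ (padicLFunction f (unitRoot W p : ℚ_[p])).order :=
    hK hp2 hord hf
  have h3 : (W.selmerCorank p : ℕ∞) ≤ (W.analyticRank : ℕ∞) := h1.trans hle
  have h4 : W.selmerCorank p ≤ W.analyticRank := by exact_mod_cast h3
  have h' : W.selmerCorank_eq_mordellWeilRank_add := hSel W
  have hid : W.selmerCorank p = W.mordellWeilRank + W.shaCorank p := h' p
  omega

end Summit.BirchSwinnertonDyer.BirchSwinnertonDyer.Theorems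

end
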